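import Summits.QuantumFields.BalabanUV.T4Continuum.Support.NE7TransportDeviationLetters
import HarnessLib

/-!
# NE7QbarLipschitzOneLevel — THE ONE-LEVEL `ℓ¹` LIPSCHITZ LETTER OF THE LINEARISED DOUBLE-BAR AVERAGE IN THE BACKGROUND:
# `Σ_{z,κ} ‖Q̄_W Y (z,κ) − Q Y (z,κ)‖ ≤ θ(η, η̄)·‖Y‖_{ℓ¹}` on the torus, `θ = (2η̄ + 2(d+1)Lη)·L^{1−d} + 2(d+1)Lη·Cl1(d,L)`,
# `η`, `η̄` the LINK radii of `W` and of `cavg L W` — the one-level input of the repaired test-field transport (TT) of (APE) (memo H15 §2)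

Cell `pub-balaban`, rung (B)+1 sub-cell t4, lineage `b2b-balaban-t4-ne7-p1`, generation 71 (CRUX PROVER NE7 #1); memo
`t4/b2b-balaban-t4-ne7-p1-g71/HUNT-H15-EXP-LANDED-TT-CURRENCY.md` §2 (TT-Q).  File F49b (over F49a `NE7TransportDeviationLetters` (the deviation letters,
the main term, the flat identities), row NE3 leaf-10's `BlockAverageDbarLinBound` (`dbarLin_W Y c = Ad_{V̄(c)⁻¹} S_W(c) + E_W(c)`,
`‖E_W(c)‖ ≤ w·(local ℓ¹ weights)`: `norm_dbarLin_sub_main_le`; `segL1`, `loopL1`, `treeL1'`) and `BlockAverageDbarLinNorms` (`sum_period_norm_dbarLin_le`,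
`lnorm_seg_eq_sum`, `l1_natCast_smul_e`), the torus counting `AveragingDeficitPeriodicCounting.sum_periodBox_box_le`, `AveragingDeficitPlaqLin.lnorm_le_region`).
WHY (memo H15 §1–§2).  The test-field transport of (APE) at the trivial flat datum must move a tangent direction `Y ∈ T(1)` to `T(Ũ)`, `Ũ = e^{A}`, at a cost
`τ‖Y‖₁` with `τ ≲ M⁻³`.  F41's letter `‖D_Ũ Y‖_{ℓ¹} ≤ Λ‖Y‖₁` cannot: the FRAME part of `D_Ũ − D_1` has columns `≈ dLα̂M⁻¹` (no `M^{−d}`).  The repair transports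
by `Y′ = Y + gaugeDir_Ũ λ − R_Ũ((Q̄_Ũ − Q̄_1)Y)` (the frames are absorbed by a FINE GAUGE DIRECTION, on which the first variation vanishes EXACTLY —
`NE3PureGaugeFirstVariation.dAction_gaugeDir`), and the only letter left is the `ℓ¹` Lipschitz bound of the STRAIGHT (double-bar) tower
`Q̄^{(k+1)}_Ũ − Q^{(k+1)}`, whose columns ARE `O(α̂M^{1−d})`.  THIS FILE is its one-level input: the double-bar average `Q̄_W = Qbar L W` against the flat
straight average `Q = Qcoarse L` in `ℓ¹ → ℓ¹` on the torus, Lipschitz in the LINK radii `η` (of `W`) and `η̄` (of `cavg L W`), with leaf-10's `O(w)`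
error (`w ≤ 2(d+1)Lη`, the loop radius, F49a) carried along.
WHAT ([folklore]; 0 def, 0 sorry).
§4 **`norm_Qbar_sub_Qcoarse_le`** (per coarse bond): `‖Qbar L W Y z κ − Qcoarse L Y z κ‖ ≤ (2η̄ + 2(d+1)Lη)·segL1(c) + 2(d+1)Lη·(1250(loopL1 + ℓ_Γ) +
   8treeL1′ + 2ℓ_Γ)(c)`, `c = (L•z, κ)`.
§5 **`sum_norm_Qbar_sub_Qcoarse_le`** — THE ONE-LEVEL LETTER ON THE TORUS: `L, M ≥ 1`, unitary `W` with link radius `η ≥ 0`, `2(d+1)Lη ≤ 1∕32`,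
   averaged links `(cavg L W)(z,κ)` within `η̄` of `1`, `Y` `(L·M)`-periodic:
   `Σ_{z∈[0,M)^d} Σ_κ ‖Qbar L W Y z κ − Qcoarse L Y z κ‖ ≤ ((2η̄ + 2(d+1)Lη)·L∕L^d + 2(d+1)Lη·Csup·d(2nbRad+1)^d)·‖Y‖_{ℓ¹([0,LM)^d)}`,
   `Csup = 1250(nbRad + L) + 8dL + 2L` (the straight segments counted EXACTLY, leaf-10's local weights through the box multiplicity — the counting of
   `BlockAverageDbarLinNorms.sum_period_norm_dbarLin_le`).
§6 `sum_norm_Qcoarse_le`: `‖Q‖_{ℓ¹→ℓ¹} ≤ L∕L^d` on the torus (leaf-10's bound at the flat background, loop radius `0`).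
HONEST FRAMING (page 1): one-level lattice kinematics; the tower (Grönwall over the levels), the TT assembly and (APE) are NOT here; nothing of Bałaban's
asserted; NOT ONE-STEP, NOT NE7; spine 0∕9; finite T⁴ rung (B)+1 — NOT infinite volume, NOT mass gap, NOT Clay.  Continuum YM on T⁴ ⇐ BetaPertH ∧ nine
spine estimates (0/9 proved); BetaPertH ⇐ (D1) ∧ (D4) ∧ CAP+tail; G-an2-4 gates asym, D1 and NE2/3/4.
-/

set_option autoImplicit false

open scoped BigOperators Matrix.Norms.L2Operator
open NormedSpace Finset

namespace Summit.QuantumFields.BalabanUV.T4Continuum.NE7QbarLipschitzOneLevel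

open Literature.MathematicalPhysics.QuantumFieldTheory.Balaban1983to89
open B7Prop1Explicit B7Prop2Explicit MatrixLog UnitaryModel
open T4AveragingDeficitWall (IsUnitaryCfg Ad dirL1 box)
open T4AveragingDeficitWallBoundary (periodBox blockSites_periodBox sum_blocks_eq sum_periodBox_shift)
open AveragingDeficitPeriodicCounting (IsPeriodicDir)
open AveragingDeficitTransport (lnorm)
open AveragingDeficitChartCalculus (cavg)
open BlockAveragePushDirSplit (flat dbarLin)
open BlockAverageVaryHolo (nbRad)
open BlockAverageDbarLinBound (segMain segL1 loopL1 treeL1' norm_dbarLin_sub_main_le lnorm_nonneg loopL1_nonneg treeL1'_nonneg segL1_nonneg)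
open BlockAverageDbarLinNorms (lnorm_seg_eq_sum sum_period_norm_dbarLin_le)
open NE3TangentFlatStructure (Qcoarse)
open NE3TangentCovariantStructure (Qbar)
open NE3TangentCovariantTower (Qbar_flat)
open NE7TransportDeviationLetters (norm_Wcx_sub_one_le_of_links norm_Ad_segMain_sub_flat_le Wcx_flat Qcoarse_eq_segMain_flat)

noncomputable section

variable {d : ℕ} {n : Type*} [Fintype n] [DecidableEq n]

/-! ## §4 Per coarse bond -/

/-- **PER COARSE BOND**: for a unitary `W` with link radius `η ≥ 0`, `2(d+1)Lη ≤ 1∕32`, and averaged links `(cavg L W)(z,κ)` within `η̄` of `1`,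
`‖Qbar L W Y z κ − Qcoarse L Y z κ‖ ≤ (2η̄ + 2(d+1)Lη)·segL1(c) + 2(d+1)Lη·(1250(loopL1(c) + ℓ_Γ(c)) + 8treeL1′(c) + 2ℓ_Γ(c))`, `c = (L•z, κ)`:
leaf-10's `dbarLin_W = Ad_{V̄⁻¹}S_W + E_W` with the loop radius `w = 2(d+1)Lη` (§1), §2 for the main term, §3 for the flat side. [folklore] -/
theorem norm_Qbar_sub_Qcoarse_le [Nonempty n] {L : ℕ} (hL : 1 ≤ L) {W : Site d → Fin d → (Matrix n n ℂ)ˣ} (hW : IsUnitaryCfg W) {η : ℝ}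
    (hη : ∀ (x : Site d) (μ : Fin d), ‖((W x μ : (Matrix n n ℂ)ˣ) : Matrix n n ℂ) - 1‖ ≤ η) (hη0 : 0 ≤ η)
    (hsmall : 2 * ((d : ℝ) + 1) * L * η ≤ 1 / 32) {ηb : ℝ}
    (hηb : ∀ (z : Site d) (κ : Fin d), ‖((cavg L W z κ : (Matrix n n ℂ)ˣ) : Matrix n n ℂ) - 1‖ ≤ ηb)
    (Y : Site d → Fin d → Matrix n n ℂ) (z : Site d) (κ : Fin d) :
    ‖Qbar L W Y z κ - Qcoarse L Y z κ‖
      ≤ (2 * ηb + 2 * (((d : ℝ) + 1) * L) * η) * segL1 L Y ((L : ℤ) • z) κ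
        + (2 * ((d : ℝ) + 1) * L * η) * (1250 * (loopL1 L Y ((L : ℤ) • z) κ + lnorm Y ((L : ℤ) • z) (seg κ L))
            + 8 * treeL1' L Y ((L : ℤ) • z) κ + 2 * lnorm Y ((L : ℤ) • z) (seg κ L)) := by
  letI : CStarAlgebra (Matrix n n ℂ) := {}
  have hQ : Qbar L W Y z κ = dbarLin L W Y ((L : ℤ) • z) κ := by unfold Qbar; rfl
  have hQ0 : Qcoarse L Y z κ = segMain L (flat (d := d) (n := n)) Y ((L : ℤ) • z) κ := Qcoarse_eq_segMain_flat hL Y z κ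
  have hWcx : ∀ r : Fin d → Fin L,
      ‖((Wcx L W ((L : ℤ) • z) κ (boxVec L r) : (Matrix n n ℂ)ˣ) : Matrix n n ℂ) - 1‖ ≤ 2 * ((d : ℝ) + 1) * L * η :=
    fun r => norm_Wcx_sub_one_le_of_links L hW hη hη0 ((L : ℤ) • z) κ r
  have hE := norm_dbarLin_sub_main_le L hL hW Y ((L : ℤ) • z) κ hsmall hWcx
  have h14 : ∀ r : Fin d → Fin L,
      ‖((Wcx L W ((L : ℤ) • z) κ (boxVec L r) : (Matrix n n ℂ)ˣ) : Matrix n n ℂ) - 1‖ ≤ 1 / 4 :=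
    fun r => (hWcx r).trans (hsmall.trans (by norm_num))
  have hbu : bavg L W ((L : ℤ) • z) κ ∈ unitaryUnits (Matrix n n ℂ) := bavg_mem_unitaryUnits (fun y μ => hW y μ) L ((L : ℤ) • z) κ h14
  have hb1 : ‖((bavg L W ((L : ℤ) • z) κ : (Matrix n n ℂ)ˣ) : Matrix n n ℂ) - 1‖ ≤ ηb := by
    have h := hηb z κ
    unfold AveragingDeficitChartCalculus.cavg at h
    exact h
  have hM := norm_Ad_segMain_sub_flat_le L hW hη hη0 hbu hb1 Y ((L : ℤ) • z) κ
  rw [hQ, hQ0]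
  have e : dbarLin L W Y ((L : ℤ) • z) κ - segMain L (flat (d := d) (n := n)) Y ((L : ℤ) • z) κ
      = (dbarLin L W Y ((L : ℤ) • z) κ - Ad (bavg L W ((L : ℤ) • z) κ)⁻¹ (segMain L W Y ((L : ℤ) • z) κ))
        + (Ad (bavg L W ((L : ℤ) • z) κ)⁻¹ (segMain L W Y ((L : ℤ) • z) κ) - segMain L (flat (d := d) (n := n)) Y ((L : ℤ) • z) κ) := by
    abel
  rw [e]
  refine (norm_add_le _ _).trans ?_
  refine (add_le_add hE hM).trans (le_of_eq ?_)
  ring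

/-! ## §5 THE ONE-LEVEL LETTER ON THE TORUS -/

/-- **THE ONE-LEVEL `ℓ¹` LIPSCHITZ LETTER OF THE DOUBLE-BAR AVERAGE ON THE TORUS.**  `L, M ≥ 1`; `W` unitary with link radius `η ≥ 0`,
`2(d+1)Lη ≤ 1∕32`; averaged links `(cavg L W)(z,κ)` within `η̄` of `1`; `Y` an `(L·M)`-periodic direction field.  Then
`Σ_{z∈[0,M)^d} Σ_κ ‖Qbar L W Y z κ − Qcoarse L Y z κ‖ ≤ ((2η̄ + 2(d+1)Lη)·L∕L^d + 2(d+1)Lη·Csup·d(2nbRad+1)^d)·‖Y‖_{ℓ¹([0,LM)^d)}`,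
`Csup = 1250(nbRad + L) + 8dL + 2L`: §4 per bond; the straight segments are counted EXACTLY (every fine bond lies on `L` segments of weight `L^{−d}`,
`sum_blocks_eq` + `sum_periodBox_shift`); the local weights of leaf-10's error through the box multiplicity `(2nbRad+1)^d`
(`AveragingDeficitPeriodicCounting.sum_periodBox_box_le`) — the counting of `BlockAverageDbarLinNorms.sum_period_norm_dbarLin_le`. [folklore] -/
theorem sum_norm_Qbar_sub_Qcoarse_le [Nonempty n] {L M : ℕ} (hL : 1 ≤ L) (hM : 1 ≤ M)
    {W : Site d → Fin d → (Matrix n n ℂ)ˣ} (hW : IsUnitaryCfg W) {η : ℝ}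
    (hη : ∀ (x : Site d) (μ : Fin d), ‖((W x μ : (Matrix n n ℂ)ˣ) : Matrix n n ℂ) - 1‖ ≤ η) (hη0 : 0 ≤ η)
    (hsmall : 2 * ((d : ℝ) + 1) * L * η ≤ 1 / 32) {ηb : ℝ}
    (hηb : ∀ (z : Site d) (κ : Fin d), ‖((cavg L W z κ : (Matrix n n ℂ)ˣ) : Matrix n n ℂ) - 1‖ ≤ ηb)
    (Y : Site d → Fin d → Matrix n n ℂ) (hY : IsPeriodicDir Y ((L : ℤ) * M)) :
    ∑ z ∈ periodBox M, ∑ κ : Fin d, ‖Qbar L W Y z κ - Qcoarse L Y z κ‖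
      ≤ ((2 * ηb + 2 * (((d : ℝ) + 1) * L) * η) * ((L : ℝ) / (L : ℝ) ^ d)
          + (2 * ((d : ℝ) + 1) * L * η)
            * ((1250 * ((nbRad d L : ℝ) + L) + 8 * (d * L) + 2 * L) * (d * (2 * nbRad d L + 1) ^ d)))
        * dirL1 Y (periodBox (L * M)) := by
  have hLM : 1 ≤ L * M := Nat.one_le_iff_ne_zero.mpr (Nat.mul_ne_zero (by omega) (by omega))
  have hwt := BlockAveragePushDirSplit.sum_blockWeight_eq_one (d := d) L hL
  have hper : ∀ (κ : Fin d) (x : Site d) (i : Fin d), ‖Y (x + ((L * M : ℕ) : ℤ) • e i) κ‖ = ‖Y x κ‖ := by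
    intro κ x i
    rw [show (((L * M : ℕ) : ℤ)) = (L : ℤ) * M by push_cast; ring, hY x i κ]
  set C : ℝ := 1250 * ((nbRad d L : ℝ) + L) + 8 * (d * L) + 2 * L with hC
  set a : ℝ := 2 * ηb + 2 * (((d : ℝ) + 1) * L) * η with ha
  set w : ℝ := 2 * ((d : ℝ) + 1) * L * η with hw
  have hw0 : 0 ≤ w := by rw [hw]; positivity
  have hC0 : 0 ≤ C := by rw [hC]; positivity
  -- (1) per bond, the local weights against the box sum
  have hpt : ∀ (y : Site d) (κ : Fin d), ‖Qbar L W Y y κ - Qcoarse L Y y κ‖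
      ≤ a * segL1 L Y ((L : ℤ) • y) κ + w * (C * dirL1 Y (box (nbRad d L) ((L : ℤ) • y))) := by
    intro y κ
    have h := norm_Qbar_sub_Qcoarse_le hL hW hη hη0 hsmall hηb Y y κ
    set q : Site d := (L : ℤ) • y with hq
    refine h.trans (add_le_add le_rfl (mul_le_mul_of_nonneg_left ?_ hw0))
    have hD0 : 0 ≤ dirL1 Y (box (nbRad d L) q) := by
      unfold dirL1; exact Finset.sum_nonneg fun _ _ => Finset.sum_nonneg fun _ _ => norm_nonneg _
    have hseg0 : lnorm Y q (seg κ L) ≤ L * dirL1 Y (box (nbRad d L) q) := by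
      have h := AveragingDeficitPlaqLin.lnorm_le_region Y (z := q) (q := q) (R := nbRad d L) (seg κ (L : ℤ))
        (by rw [BlockAverageVaryHolo.l1_sub_self, length_seg, Int.natAbs_natCast, nbRad]; omega)
      rwa [length_seg, Int.natAbs_natCast] at h
    have hloopL1 : loopL1 L Y q κ ≤ (nbRad d L : ℝ) * dirL1 Y (box (nbRad d L) q) := by
      unfold loopL1
      calc _ ≤ ∑ _r : Fin d → Fin L, ((L : ℝ) ^ d)⁻¹ * ((nbRad d L : ℝ) * dirL1 Y (box (nbRad d L) q)) := by
            refine Finset.sum_le_sum fun r _ => mul_le_mul_of_nonneg_left ?_ (by positivity)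
            have h := AveragingDeficitPlaqLin.lnorm_le_region Y (z := q) (q := q) (R := nbRad d L)
              (AveragingDeficitSideDeriv.loopWord L κ (boxVec L r))
              (by rw [BlockAverageVaryHolo.l1_sub_self, zero_add]; exact BlockAverageVaryHolo.length_loopWord_le L κ r)
            exact h.trans (mul_le_mul_of_nonneg_right (by exact_mod_cast BlockAverageVaryHolo.length_loopWord_le L κ r) hD0)
        _ = _ := by rw [← Finset.sum_mul, hwt, one_mul]
    have htreeL1 : treeL1' L Y q κ ≤ (d * L : ℝ) * dirL1 Y (box (nbRad d L) q) := by
      unfold treeL1'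
      calc _ ≤ ∑ _r : Fin d → Fin L, ((L : ℝ) ^ d)⁻¹ * ((d * L : ℝ) * dirL1 Y (box (nbRad d L) q)) := by
            refine Finset.sum_le_sum fun r _ => mul_le_mul_of_nonneg_left ?_ (by positivity)
            have hlen : (treeWord (boxVec L r)).length ≤ d * L := by rw [length_treeWord]; exact l1_boxVec_le L r
            have hl := BlockAverageDbarLinNorms.l1_natCast_smul_e (d := d) L κ
            have h := AveragingDeficitPlaqLin.lnorm_le_region Y (z := q) (q := q + (L : ℤ) • e κ) (R := nbRad d L)
              (treeWord (boxVec L r)) (by rw [add_sub_cancel_left, hl, length_treeWord, nbRad]; have := l1_boxVec_le L r; omega)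
            exact h.trans (mul_le_mul_of_nonneg_right (by exact_mod_cast hlen) hD0)
        _ = _ := by rw [← Finset.sum_mul, hwt, one_mul]
    rw [hC]
    nlinarith [hseg0, hloopL1, htreeL1, hD0, loopL1_nonneg L Y q κ, treeL1'_nonneg L Y q κ, lnorm_nonneg Y q (seg κ L)]
  -- (2) the main term, counted exactly
  set f : Fin d → ℕ → Site d → (Fin d → Fin L) → ℝ :=
    fun κ i y r => ‖Y ((L : ℤ) • y + boxVec L r + (i : ℤ) • e κ) κ‖ with hf
  have htile : ∀ (κ : Fin d) (i : ℕ),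
      ∑ y ∈ periodBox M, ∑ r : Fin d → Fin L, f κ i y r = ∑ x ∈ periodBox (L * M), ‖Y x κ‖ := by
    intro κ i
    simp only [hf]
    rw [sum_blocks_eq L hL (periodBox M) (fun x => ‖Y (x + (i : ℤ) • e κ) κ‖), blockSites_periodBox L M hL]
    exact sum_periodBox_shift (L * M) hLM (g := fun x => ‖Y x κ‖) (hper κ) ((i : ℤ) • e κ)
  have hmain : ∑ y ∈ periodBox M, ∑ κ : Fin d, segL1 L Y ((L : ℤ) • y) κ = (L : ℝ) / (L : ℝ) ^ d * dirL1 Y (periodBox (L * M)) := by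
    set w' : ℝ := ((L : ℝ) ^ d)⁻¹ with hw'
    calc ∑ y ∈ periodBox M, ∑ κ : Fin d, segL1 L Y ((L : ℤ) • y) κ
        = ∑ y ∈ periodBox M, ∑ κ : Fin d, ∑ r : Fin d → Fin L, w' * ∑ i ∈ Finset.range L, f κ i y r := by
          refine Finset.sum_congr rfl fun y _ => Finset.sum_congr rfl fun κ _ => ?_
          unfold segL1
          exact Finset.sum_congr rfl fun r _ => by rw [lnorm_seg_eq_sum]
      _ = ∑ κ : Fin d, ∑ y ∈ periodBox M, ∑ r : Fin d → Fin L, w' * ∑ i ∈ Finset.range L, f κ i y r := Finset.sum_comm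
      _ = ∑ κ : Fin d, ∑ i ∈ Finset.range L, w' * ∑ y ∈ periodBox M, ∑ r : Fin d → Fin L, f κ i y r := by
          refine Finset.sum_congr rfl fun κ _ => ?_
          calc ∑ y ∈ periodBox M, ∑ r : Fin d → Fin L, w' * ∑ i ∈ Finset.range L, f κ i y r
              = ∑ y ∈ periodBox M, ∑ r : Fin d → Fin L, ∑ i ∈ Finset.range L, w' * f κ i y r := by
                simp only [Finset.mul_sum]
            _ = ∑ y ∈ periodBox M, ∑ i ∈ Finset.range L, ∑ r : Fin d → Fin L, w' * f κ i y r :=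
                Finset.sum_congr rfl fun y _ => Finset.sum_comm
            _ = ∑ i ∈ Finset.range L, ∑ y ∈ periodBox M, ∑ r : Fin d → Fin L, w' * f κ i y r := Finset.sum_comm
            _ = ∑ i ∈ Finset.range L, w' * ∑ y ∈ periodBox M, ∑ r : Fin d → Fin L, f κ i y r := by
                simp only [Finset.mul_sum]
      _ = ∑ κ : Fin d, ∑ _i ∈ Finset.range L, w' * ∑ x ∈ periodBox (L * M), ‖Y x κ‖ := by
          refine Finset.sum_congr rfl fun κ _ => Finset.sum_congr rfl fun i _ => ?_
          rw [htile κ i]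
      _ = (L : ℝ) / (L : ℝ) ^ d * dirL1 Y (periodBox (L * M)) := by
          simp only [Finset.sum_const, Finset.card_range, nsmul_eq_mul, hw']
          rw [dirL1, Finset.sum_comm, Finset.mul_sum]
          refine Finset.sum_congr rfl fun κ _ => ?_
          ring
  -- (3) the error weights, through the box multiplicity
  have hbox : ∑ y ∈ periodBox M, dirL1 Y (box (nbRad d L) ((L : ℤ) • y))
      ≤ (2 * nbRad d L + 1) ^ d * dirL1 Y (periodBox (L * M)) := by
    unfold dirL1
    refine AveragingDeficitPeriodicCounting.sum_periodBox_box_le L M hL hM (nbRad d L)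
      (fun _ => Finset.sum_nonneg fun _ _ => norm_nonneg _) fun x κ => ?_
    rw [AveragingDeficitPeriodicCounting.natCast_mul_period]
    exact Finset.sum_congr rfl fun μ _ => by rw [hY x κ μ]
  -- (4) assemble
  have hsplit : ∑ y ∈ periodBox M, ∑ κ : Fin d, (a * segL1 L Y ((L : ℤ) • y) κ + w * (C * dirL1 Y (box (nbRad d L) ((L : ℤ) • y))))
      = a * ∑ y ∈ periodBox M, ∑ κ : Fin d, segL1 L Y ((L : ℤ) • y) κ
        + w * C * ((d : ℝ) * ∑ y ∈ periodBox M, dirL1 Y (box (nbRad d L) ((L : ℤ) • y))) := by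
    simp only [Finset.sum_add_distrib, Finset.sum_const, Finset.card_univ, Fintype.card_fin, nsmul_eq_mul, Finset.mul_sum]
    congr 1
    refine Finset.sum_congr rfl fun y _ => ?_
    ring
  calc ∑ y ∈ periodBox M, ∑ κ : Fin d, ‖Qbar L W Y y κ - Qcoarse L Y y κ‖
      ≤ ∑ y ∈ periodBox M, ∑ κ : Fin d, (a * segL1 L Y ((L : ℤ) • y) κ + w * (C * dirL1 Y (box (nbRad d L) ((L : ℤ) • y)))) :=
        Finset.sum_le_sum fun y _ => Finset.sum_le_sum fun κ _ => hpt y κ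
    _ = a * ∑ y ∈ periodBox M, ∑ κ : Fin d, segL1 L Y ((L : ℤ) • y) κ
        + w * C * ((d : ℝ) * ∑ y ∈ periodBox M, dirL1 Y (box (nbRad d L) ((L : ℤ) • y))) := hsplit
    _ ≤ a * ((L : ℝ) / (L : ℝ) ^ d * dirL1 Y (periodBox (L * M)))
        + w * C * ((d : ℝ) * ((2 * nbRad d L + 1) ^ d * dirL1 Y (periodBox (L * M)))) := by
        rw [hmain]
        refine add_le_add le_rfl (mul_le_mul_of_nonneg_left (mul_le_mul_of_nonneg_left hbox (Nat.cast_nonneg _)) ?_)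
        positivity
    _ = (a * ((L : ℝ) / (L : ℝ) ^ d) + w * (C * (d * (2 * nbRad d L + 1) ^ d))) * dirL1 Y (periodBox (L * M)) := by ring

/-! ## §6 The flat operator norm -/

/-- **`‖Q‖_{ℓ¹→ℓ¹} ≤ L∕L^d` on the torus**: `Σ_{z∈[0,M)^d} Σ_κ ‖Qcoarse L Y z κ‖ ≤ (L∕L^d)·‖Y‖_{ℓ¹([0,LM)^d)}` for an `(L·M)`-periodic `Y`
(leaf-10's `sum_period_norm_dbarLin_le` at the flat background, loop radius `0`). [folklore] -/
theorem sum_norm_Qcoarse_le [Nonempty n] {L M : ℕ} (hL : 1 ≤ L) (hM : 1 ≤ M) (Y : Site d → Fin d → Matrix n n ℂ)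
    (hY : IsPeriodicDir Y ((L : ℤ) * M)) :
    ∑ z ∈ periodBox M, ∑ κ : Fin d, ‖Qcoarse L Y z κ‖ ≤ (L : ℝ) / (L : ℝ) ^ d * dirL1 Y (periodBox (L * M)) := by
  have h := sum_period_norm_dbarLin_le (d := d) (n := n) hL hM (T4AveragingDeficitWall.flat_mem_classes (d := d) (n := n) le_rfl).1 (w := 0) le_rfl (by norm_num)
    (fun q κ r => by rw [Wcx_flat, sub_self, norm_zero]) Y hY
  rw [zero_mul, add_zero] at h
  have e : ∀ (z : Site d) (κ : Fin d), Qcoarse L Y z κ = dbarLin L (flat (d := d) (n := n)) Y ((L : ℤ) • z) κ := by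
    intro z κ
    rw [← Qbar_flat (d := d) (n := n) hL Y]
    rfl
  simp only [e]
  exact h

end

end Summit.QuantumFields.BalabanUV.T4Continuum.NE7QbarLipschitzOneLevel

-- Build-lane re-trigger (custody by lineage t4-ne7-p2, gen 85, 2026-08-24; the file and its pid of record p371799 are the OWNER t4-ne7-p1's):
-- comment-only re-land of the tree bytes d720cf0f20af7f0d; every declaration byte-identical.  Accepted inside the no-olean cohort of
-- `ops/buildfix/UNBUILT-ACCEPTED-20260824T1600.txt` l.523 (last build event rc 75 NO-HOST, attempt 62); F50 p375805 has been deferred 72 times on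
-- `…NE7QbarLipschitzOneLevel:no-olean`.  Cf. ops-buildfix-2's comment-only re-land p372431 of `B7Prop4Flat`.
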